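import Summits.HodgeConjecture.HodgeConjecture.Theorems.HeckePrymWeilWeilTwelvefoldsSqrtMinus7AimedSplitProductSevenHolds
import Literature.AlgebraicGeometry.HodgeTheory.WeilSurfaceCMSquareAlgebraic
import Literature.AlgebraicGeometry.HodgeTheory.WeilClassesFourfoldsProofs
import Summits.HodgeConjecture.HodgeConjecture.Theorems.HeckePrymWeilHeckePrymAnchorsUpgrade
import HarnessLib

/-!
# Crux `WeilTwelvefoldsSqrtMinus7` (stmt-HodgeConjecture-1261), line `isotypic-unimodular-saturation` —
# lemmas for stub `stub_reach` (partner surface, aiming, algebraic Weil plane of the CM square)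

The registered stub `stub_reach` of the line (skeleton
`Cruxes/WeilTwelvefoldsSqrtMinus7/Lines/isotypic_unimodular_saturation.lean`, Stub 5: REACH) asks, for a
`ℚ(√-7)`-Weil twelvefold `(A, φ)` witnessed by a non-zero rational `(6,6)` Weil class, for (i) a partner
Weil SURFACE `(B, φ_B)`, `φ_B ≫ φ_B = -7`, with a DESCENT PAIR, and (ii)–(iii) a smooth projective
family of `ℚ(√-7)`-Weil 14-folds through `A × B` reaching a Hecke–Prym-product anchor, on which the
rational `(7,7)` Weil classes of `A × B` globalise. This file proves the parts of that infrastructure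
the tree supports today, all for the CM square `B = E × E`, `E = ℂ/(ℤ + ℤ√-7)`, `φ_B = ([√-7], -[√-7])`
built by the sibling line `amnesic-secant-sheaves-split-fourteenfolds` (`exists_cmWeilSurface_descentPair`):

* `exists_weilSurface_descentPair_seven` — conjunct (i) of `stub_reach` VERBATIM (a Weil surface with
  `φ_B ≫ φ_B = -7` and a descent pair `(b₊, b₋, η)` in the stub's typing);
* `exists_cmSquare_descentPair_algebraic_aiming` — the same surface together with the two further
  properties the reach argument consumes: its single-operator Weil plane
  `Eig((𝟙+φ_B)^*, (1+i√7)²) ⊔ Eig((𝟙+φ_B)^*, (1-i√7)²) ⊆ H²(B(ℂ); ℂ)` consists of ALGEBRAIC classes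
  (Schoen 1998 §10: `weilClassesPlus/Minus_cmSquare_le_algebraicClasses` + the typing
  `HeckePrymWeilLine.stub_upgrade`, `p = 7`), and the AIMING property
  (`stub_aimedFrameOfModel` + the closed Hodge–Riemann leaf): for every `ℚ(√-7)`-Weil `2n`-fold
  `(A, φ)`, `n ≥ 1`, with a non-zero rational `(n,n)` Weil class, `(A × B, φ × φ_B)` is of HYPERBOLIC
  Weil type in half-dimension `n + 1` for the `K`-symmetrised hyperplane class of some projective
  embedding — so both `A × B` (for the crux's `A`) and `P' × B` (for a Hecke–Prym `P'`) lie on the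
  hyperbolic (= split, discriminant `(-1)⁷`) component of `ℚ(√-7)`-Weil 14-folds, which is what
  replaces "Landherr + weights tuning the discriminant" in the skeleton's informal proof of Stub 5;
* `prodLift_comp_self_eq_neg_zsmul` — `(φ × ψ)² = -d` in the route's `ℤ`-scalar typing.

No new definitions, no named facts, no `sorry`.
-/

noncomputable section

-- single-problem summit (Problem = Summit): the mandated namespace repeats `HodgeConjecture`.
set_option linter.dupNamespace false

open CategoryTheory
open Literature.AlgebraicGeometry Literature.AlgebraicGeometry.Motives
  Literature.AlgebraicGeometry.HodgeTheory Literature.AlgebraicTopology.SingularHomology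
open Summit.HodgeConjecture.HodgeConjecture.Theorems.WeilTwelvefoldsSqrtMinus7.AmnesicSecantSheaves
  (exists_cmWeilSurface_descentPair stub_aimedFrameOfModel stub_hodgeRiemannDegreeOne)
open Summit.HodgeConjecture.HodgeConjecture.Theorems.HeckePrymWeilLine (stub_upgrade)

namespace Summit.HodgeConjecture.HodgeConjecture.Theorems.WeilTwelvefoldsSqrtMinus7.IsotypicUnimodularSaturation

/-- **`(φ × ψ)² = -d` in the route's `ℤ`-scalar typing**: for `φ ≫ φ = -((d : ℤ) • 𝟙 A)` and
`ψ ≫ ψ = -((d : ℤ) • 𝟙 B)` the product endomorphism `φ × ψ = prodLift (fst ≫ φ) (snd ≫ ψ)` of `A × B`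
squares to `-((d : ℤ) • 𝟙 (A × B))` (the tree's `prodLift_comp_self_eq_neg_nsmul`, rescalared).
[cite: Schoen1998HodgeWeilAddendum, §10 (proof of the Proposition)] -/
theorem prodLift_comp_self_eq_neg_zsmul {A B : AbelianVariety ℂ} {φ : A ⟶ A} {ψ : B ⟶ B} {d : ℕ}
    (hφ : φ ≫ φ = -((d : ℤ) • 𝟙 A)) (hψ : ψ ≫ ψ = -((d : ℤ) • 𝟙 B)) :
    AbelianVariety.prodLift (AbelianVariety.fst A B ≫ φ) (AbelianVariety.snd A B ≫ ψ) ≫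
        AbelianVariety.prodLift (AbelianVariety.fst A B ≫ φ) (AbelianVariety.snd A B ≫ ψ) =
      -((d : ℤ) • 𝟙 (A.prod B)) := by
  rw [natCast_zsmul] at hφ hψ ⊢
  exact prodLift_comp_self_eq_neg_nsmul hφ hψ

/-- **Conjunct (i) of `stub_reach`: a `ℚ(√-7)`-Weil surface with a descent pair** (VERBATIM the stub's
typing). There are a complex abelian surface `B` and `φ_B : B ⟶ B` with `φ_B ≫ φ_B = -7` carrying
`b₊ ∈ Eig((𝟙+φ_B)^*, (1+i√7)²)`, `b₋ ∈ Eig((𝟙+φ_B)^*, (1-i√7)²)` with `b₊ + b₋` rational of Hodge type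
`(1,1)`, and an algebraic `η ∈ N¹H²(B)` with `b₊ ⌣ η ≠ 0`, `b₋ ⌣ η ≠ 0`. Witness: the CM square
`B = E × E`, `E = ℂ/(ℤ + ℤ√-7)`, `φ_B = ([√-7], -[√-7])`, `b₊ = pr₁^*v₊ ⌣ pr₂^*v₋`, `η = (pr₁ - pr₂)^*ω`
(`exists_cmWeilSurface_descentPair 7` of the sibling line). [cite: Schoen1998HodgeWeilAddendum, §10]
[cite: vanGeemen1994HodgeAV, Lemma 5.2 and 5.3] -/
theorem exists_weilSurface_descentPair_seven :
    ∃ (B : AbelianVariety ℂ) (φB : B ⟶ B), B.dim = 2 ∧ φB ≫ φB = -((7 : ℤ) • 𝟙 B) ∧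
      ∃ bp bm η : complexBetti B.X 2,
        bp ∈ Module.End.eigenspace (complexBetti.map (𝟙 B + φB).hom.hom.hom 2).hom
              ((1 + Complex.I * (Real.sqrt (7 : ℝ) : ℂ)) ^ 2) ∧
        bm ∈ Module.End.eigenspace (complexBetti.map (𝟙 B + φB).hom.hom.hom 2).hom
              ((1 - Complex.I * (Real.sqrt (7 : ℝ) : ℂ)) ^ 2) ∧
        IsRationalClass (bp + bm) ∧ IsOfHodgeType 2 B.X 2 1 1 (bp + bm) ∧
        η ∈ algebraicClasses B.X 1 ∧
        cupProduct (show 2 + 2 = 4 from rfl) bp η ≠ 0 ∧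
        cupProduct (show 2 + 2 = 4 from rfl) bm η ≠ 0 := by
  obtain ⟨E, φ, x, -, -, -, -, -, -, -, -, -, hBdim, hψ, bp, bm, η, hbp, hbm, hrat, hH, hη, hpη, hmη⟩ :=
    exists_cmWeilSurface_descentPair 7 (by norm_num)
  refine ⟨E.prod E, _, hBdim, by exact_mod_cast hψ, bp, bm, η, ?_, ?_, hrat, hH, hη, hpη, hmη⟩
  · simpa only [Nat.cast_ofNat] using hbp
  · simpa only [Nat.cast_ofNat] using hbm

/-- **The CM square: descent pair, ALGEBRAIC single-operator Weil plane, and aiming (all `n ≥ 1`).**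
There is a `ℚ(√-7)`-Weil surface `(B, φ_B)` (`B = E × E`, `E = ℂ/(ℤ + ℤ√-7)`, `φ_B = ([√-7], -[√-7])`)
with: a descent pair as in `exists_weilSurface_descentPair_seven`; every class of
`Eig((𝟙+φ_B)^*, (1+i√7)²) ⊔ Eig((𝟙+φ_B)^*, (1-i√7)²) ⊆ H²(B(ℂ); ℂ)` algebraic (the two Weil lines of the
CM square are spanned by algebraic classes, Schoen 1998 §10, and for `d = 7 ∉ {1,3}` the single-operator
span is the Weil plane); and for every complex abelian `2n`-fold `(A, φ)`, `n ≥ 1`, `φ ≫ φ = -7`, with a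
non-zero rational `(n,n)` class in its single-operator Weil plane, a projective embedding `e` of `A × B`
and a non-zero rational `a ∈ H²(ℙᴺ(ℂ); ℂ)` making `(A × B, φ × φ_B)` of HYPERBOLIC Weil type in
half-dimension `n + 1` for `7·e^*a + (φ × φ_B)^*e^*a` (Markman's product trick, §11.5 Step 2:
the weights of a Segre embedding tune `det H(A × B) = (-1)^{n+1}`; van Geemen 5.2–5.4).
[cite: Schoen1998HodgeWeilAddendum, §10] [cite: Markman2025SurveySecant, §11.5 Step 2]
[cite: vanGeemen1994HodgeAV, Lemma 5.2 (3), 5.3 and 5.4 (5.4.1)] -/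
theorem exists_cmSquare_descentPair_algebraic_aiming :
    ∃ (B : AbelianVariety ℂ) (φB : B ⟶ B), B.dim = 2 ∧ φB ≫ φB = -((7 : ℤ) • 𝟙 B) ∧
      (∃ bp bm η : complexBetti B.X 2,
        bp ∈ Module.End.eigenspace (complexBetti.map (𝟙 B + φB).hom.hom.hom 2).hom
              ((1 + Complex.I * (Real.sqrt (7 : ℝ) : ℂ)) ^ 2) ∧
        bm ∈ Module.End.eigenspace (complexBetti.map (𝟙 B + φB).hom.hom.hom 2).hom
              ((1 - Complex.I * (Real.sqrt (7 : ℝ) : ℂ)) ^ 2) ∧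
        IsRationalClass (bp + bm) ∧ IsOfHodgeType 2 B.X 2 1 1 (bp + bm) ∧
        η ∈ algebraicClasses B.X 1 ∧
        cupProduct (show 2 + 2 = 4 from rfl) bp η ≠ 0 ∧
        cupProduct (show 2 + 2 = 4 from rfl) bm η ≠ 0) ∧
      (∀ b : complexBetti B.X 2,
        b ∈ Module.End.eigenspace (complexBetti.map (𝟙 B + φB).hom.hom.hom 2).hom
              ((1 + Complex.I * (Real.sqrt (7 : ℝ) : ℂ)) ^ 2) ⊔
            Module.End.eigenspace (complexBetti.map (𝟙 B + φB).hom.hom.hom 2).hom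
              ((1 - Complex.I * (Real.sqrt (7 : ℝ) : ℂ)) ^ 2) →
        b ∈ algebraicClasses B.X 1) ∧
      ∀ (n : ℕ) (A : AbelianVariety ℂ) (φ : A ⟶ A), 1 ≤ n → A.dim = 2 * n →
        φ ≫ φ = -((7 : ℤ) • 𝟙 A) →
        (∃ c : complexBetti A.X (2 * n), c ≠ 0 ∧ IsRationalClass c ∧
          IsOfHodgeType (2 * n) A.X (2 * n) n n c ∧
          c ∈ Module.End.eigenspace (complexBetti.map (𝟙 A + φ).hom.hom.hom (2 * n)).hom
                ((1 + Complex.I * (Real.sqrt (7 : ℝ) : ℂ)) ^ (2 * n)) ⊔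
              Module.End.eigenspace (complexBetti.map (𝟙 A + φ).hom.hom.hom (2 * n)).hom
                ((1 - Complex.I * (Real.sqrt (7 : ℝ) : ℂ)) ^ (2 * n))) →
        ∃ (e : ProjectiveEmbedding (A.prod B).X) (a : complexBetti (projectiveSpace e.n ℂ) 2),
          IsRationalClass a ∧ a ≠ 0 ∧
          IsHyperbolicWeilType (A.prod B)
            (AbelianVariety.prodLift (AbelianVariety.fst A B ≫ φ) (AbelianVariety.snd A B ≫ φB)) (n + 1)
            ((7 : ℂ) • complexBetti.map e.ι 2 a +
              complexBetti.map (AbelianVariety.prodLift (AbelianVariety.fst A B ≫ φ)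
                (AbelianVariety.snd A B ≫ φB)).hom.hom.hom 2 (complexBetti.map e.ι 2 a)) := by
  obtain ⟨E, φ, x, hE, hφ, hxr, hxi, hxs, hM, hadd, hω, hH2, hBdim, hψ, hpair⟩ :=
    exists_cmWeilSurface_descentPair 7 (by norm_num)
  have hφ' : φ ≫ φ = -((7 : ℤ) • 𝟙 E) := hφ
  have hφn : φ ≫ φ = -(7 • 𝟙 E) := by rw [hφ, natCast_zsmul]
  -- the surface `B = E × E`, `ψ = (φ, -φ)`, in the `ℕ`-scalar typing of the Literature lemmas
  have hψn : AbelianVariety.prodLift (AbelianVariety.fst E E ≫ φ) (AbelianVariety.snd E E ≫ (-φ)) ≫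
      AbelianVariety.prodLift (AbelianVariety.fst E E ≫ φ) (AbelianVariety.snd E E ≫ (-φ)) =
        -(7 • 𝟙 (E.prod E)) := by
    rw [hψ, natCast_zsmul]
  have hBdim' : (E.prod E).dim = 2 * 1 := hBdim
  refine ⟨E.prod E, _, hBdim, hψ, hpair, ?_, ?_⟩
  · -- the single-operator Weil plane of the CM square is algebraic
    intro b hb
    have hb' : b ∈ weilClassesOf (E.prod E)
        (AbelianVariety.prodLift (AbelianVariety.fst E E ≫ φ) (AbelianVariety.snd E E ≫ (-φ))) 1 7 := by
      refine stub_upgrade 7 (by norm_num) (by norm_num) le_rfl 1 (E.prod E) _ hBdim' hψ ?_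
      simpa only [Nat.cast_ofNat] using hb
    rw [weilClassesOf] at hb'
    exact sup_le (weilClassesPlus_cmSquare_le_algebraicClasses hE (by norm_num) hφn)
      (weilClassesMinus_cmSquare_le_algebraicClasses hE (by norm_num) hφn) hb'
  · -- aiming: Hodge–Riemann in degree one (closed leaf) feeds `stub_aimedFrameOfModel`
    intro n A φA hn hA hφA hc
    have hdim : A.dim = (2 * n - 1) + 1 := by rw [hA]; omega
    have hX : IsSmoothProjective ((2 * n - 1) + 1) A.X := isSmoothProjective_of_dim_eq' hdim
    have h2n : (2 * n - 1) + 1 = 2 * n := by omega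
    have hHRA : ∀ (eA : ProjectiveEmbedding A.X) (aA : complexBetti (projectiveSpace eA.n ℂ) 2),
        IsRationalClass aA → aA ≠ 0 → ∀ (MA : HodgeModel (2 * n) A.X), MA.IsReal →
          ∃ ω₀ : complexBetti A.X (2 + 2 * (2 * n - 1)), IsRationalClass ω₀ ∧ ω₀ ≠ 0 ∧
            ∀ y : complexBetti A.X 1, MA.pullback 1 y ∈ MA.hodgePQ 1 1 0 → y ≠ 0 →
              ∃ t : ℝ, 0 < t ∧
                Complex.I • polarizationPairingOne A.X (complexBetti.map eA.ι 2 aA) (2 * n - 1) y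
                  (conjClass (ComplexPoints A.X) 1 y) = (t : ℂ) • ω₀ := by
      rw [← h2n]
      exact fun eA aA haA haA0 MA hMA => stub_hodgeRiemannDegreeOne hX eA aA haA haA0 MA hMA
    exact stub_aimedFrameOfModel E φ hE hφ' x _ hxr hxi hxs hM hadd hω hH2 n A φA hn hA hφA hc hHRA

end Summit.HodgeConjecture.HodgeConjecture.Theorems.WeilTwelvefoldsSqrtMinus7.IsotypicUnimodularSaturation

end
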